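import Summits.AtomisticToContinuum.HydrodynamicLimit.Theorems.OneFlightGossipEngineCollisionActivityTailsPlaqueSplit
import HarnessLib

/-!
# `CollisionActivityTails` (stmt-AtomisticToContinuum-13734), line `plaque-thinning-count-ld`: the DILUTE-PHASE guards (lead's reshape, cycle 1)

Helper file (`--supports stmt-AtomisticToContinuum-13734`), sequel of `…Theorems.CollisionActivityTailsPlaqueSplit` (p128811), recording the
reshape forced by the wave-1 audit of stub 2 (worker w-untaggedLMGF, evidence `stub_equilibriumUntaggedLMGF.md`):

* the count criterion of `Tagged` compares the occupancy of the ball of mean occupancy `K'` with `y K'`, and hard-core exclusion caps that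
  occupancy at `≈ √2 K'/σ³`; for `y ≳ √2/σ³` nothing is ever count-tagged, a macroscopic cold close-packed droplet is untagged, outlives the
  window and gives its bulk members unbounded cold untagged activity at a `τ`-INDEPENDENT equilibrium cost — so `∀ y > 0 ∃ V₀` in
  `EquilibriumUntaggedActivityLMGF` / `UntaggedActivityTails` is FALSE. Repair: the DENSE-PHASE GUARD `y · σ³ ≤ 1` (untagged matter then stays
  below `π/6 ≈ 0.52` volume fraction at every scale `≥ K`): `EquilibriumUntaggedActivityLMGF'`, `UntaggedActivityTails'`;
* the composition uses `y := y₀(t)` from the abnormal branch, so that branch must now deliver `y₀ · σ³ ≤ 1` (`AbnormalActivityVanishes'`); its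
  mechanism (geometric series of marked multi-point fluxes) gives `y₀ ≍ e C (2π/β)^{3/2}` from the envelope constants, so the IMPORT must carry
  DILUTE constants, `C (2π/β)^{3/2} σ³ · max(1, β⁻¹) ≤ κ` for any prescribed `κ` once `σ` is small (`PreShockEnvelopeDilute`; the factor `max(1,β⁻¹)`
  serves the KINETIC tag, whose geometric series needs `y₀ ≥ 12 C(2π/β)^{3/2}/β` — wave-1 worker w-abnormal, work log §5): a Gaussian envelope with
  `C (2π/β)^{3/2} ≳ 1/σ³` does not exclude close-packed droplets at all (an `m`-droplet in a ball of mean occupancy `0.71 m σ³` costs only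
  `(1.93 C(2π/β)^{3/2} σ³)^m` under it). This is STRONGER than item 13677 as typed (constants free after `σ`), and honestly so: the bridge
  `preShockEnvelope_of_dilute` goes the other way only. At equilibrium `C (2π/β)^{3/2} = 2`, `β = 1/θ₀` (p129630), so the dilute envelope holds for `2σ³ max(1, θ₀) ≤ κ`;
* stub 5 is re-typed LOCALLY in the profiles and the horizon (`AbnormalFromEnvelope`: an envelope on `[0, t₁]` with dilute constants gives the
  abnormal-mean bound for starts `≤ t < t₁`), which yields both the global statement (`abnormalActivityVanishes'_of_local`, `t₁ := (t+T)/2`) and,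
  with the landed equilibrium envelope, the equilibrium rung of the abnormal branch;
* the composition with guards: `stub_plaqueCompositionDilute : UntaggedActivityTails' → AbnormalActivityVanishes' → CollisionActivityTails`.

References: as in `…PlaqueSplit`; D. Ruelle, *Statistical Mechanics* (1969) §4.2 for the hard-core occupancy cap. Bookkeeping only.
-/

noncomputable section

open MeasureTheory Set Filter Topology
open scoped ENNReal

namespace Summit.AtomisticToContinuum.HydrodynamicLimit.Theorems.CollisionActivityTailsPlaqueSplit

open Literature.MathematicalPhysics.KineticTheory Literature.Analysis.FluidPDE
open Summit.AtomisticToContinuum.HydrodynamicLimit.Theorems.CollisionActivityTailsActivityDomination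
  (Flow Cfg window act tdist nearCount)
open Summit.AtomisticToContinuum.HydrodynamicLimit.Theorems.CollisionActivityTailsNearFieldKineticTails
  (tailFn tailFn_of_lt tailFn_of_le tailFn_nonneg)
open Summit.AtomisticToContinuum.HydrodynamicLimit.Theorems.CollisionActivityTailsEndpointTails (ae_mem_good_localGibbsLaw)

/-! ## §1' The guarded branch statements -/

/-- `EquilibriumUntaggedActivityLMGF` with the dense-phase guard `y · σ³ ≤ 1` on the tagging threshold (otherwise verbatim). -/
def EquilibriumUntaggedActivityLMGF' : Prop :=
  ∀ (a₀ θ₀ : ℝ), 0 < a₀ → 0 < θ₀ → ∃ σ₀ : ℝ, 0 < σ₀ ∧ ∀ σ : ℝ, 0 < σ → σ < σ₀ →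
    ∀ y : ℝ, 0 < y → y * σ ^ 3 ≤ 1 → ∃ V₀ : ℝ, 0 < V₀ ∧ ∀ V : ℝ, V₀ ≤ V → ∀ Θ : ℝ, 0 < Θ → ∀ K : ℕ,
    ∀ γ : ℝ, 0 < γ → ∀ δ : ℝ, 0 < δ → ∃ τ₀ : ℝ, 0 < τ₀ ∧ ∀ τ : ℝ, τ₀ ≤ τ → ∃ N₀ : ℕ, ∀ N : ℕ, N₀ ≤ N →
    ∀ (Φ : Flow σ N) (s : ℝ), 0 ≤ s →
      AEMeasurable (fun z => ∑ i : Fin (N + 1), tailFn V (uncAct Θ y K Φ τ s i z)) (gibbs σ a₀ θ₀ N Φ) ∧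
      ∫⁻ z, ENNReal.ofReal (Real.exp (γ * ∑ i : Fin (N + 1), tailFn V (uncAct Θ y K Φ τ s i z)))
          ∂(gibbs σ a₀ θ₀ N Φ) ≤ ENNReal.ofReal (Real.exp (δ * ((N : ℝ) + 1)))

/-- `UntaggedActivityTails` with the dense-phase guard `y · σ³ ≤ 1` (otherwise verbatim). -/
def UntaggedActivityTails' : Prop :=
  ∀ (a₀ θ₀ : T3 → ℝ) (u₀ : T3 → V3), Continuous a₀ → Continuous θ₀ → Continuous u₀ →
    (∀ x, 0 < a₀ x) → (∀ x, 0 < θ₀ x) → ∃ σ₀ : ℝ, 0 < σ₀ ∧ ∀ σ : ℝ, 0 < σ → σ < σ₀ →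
    ∀ (T : ℝ) (ρ θ : ℝ → T3 → ℝ) (u : ℝ → T3 → V3), IsHardSphereEulerSolution σ T ρ u θ →
    ∀ Φ : (N : ℕ) → Flow σ N,
    TendstoHydroFieldsAt (fun N => localGibbsLaw σ a₀ u₀ θ₀ N (Φ N)) Φ ρ u θ 0 →
    ∀ t ∈ Set.Ico 0 T, ∀ y : ℝ, 0 < y → y * σ ^ 3 ≤ 1 → ∃ V₀ : ℝ, 0 < V₀ ∧ ∀ V : ℝ, V₀ ≤ V → ∀ Θ : ℝ, 0 < Θ → ∀ K : ℕ,
    ∀ η : ℝ, 0 < η → ∃ τ₀ : ℝ, 0 < τ₀ ∧ ∀ τ : ℝ, τ₀ ≤ τ → ∃ N₀ : ℕ, ∀ N : ℕ, N₀ ≤ N → ∀ s ∈ Set.Icc 0 t,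
      AEMeasurable (fun z => ∑ i : Fin (N + 1), tailFn V (uncAct Θ y K (Φ N) τ s i z))
          (localGibbsLaw σ a₀ u₀ θ₀ N (Φ N)) ∧
      ∫⁻ z, ENNReal.ofReal (((N : ℝ) + 1)⁻¹ * ∑ i : Fin (N + 1), tailFn V (uncAct Θ y K (Φ N) τ s i z))
        ∂(localGibbsLaw σ a₀ u₀ θ₀ N (Φ N)) ≤ ENNReal.ofReal η

/-- **STUB 4' — PRE-SHOCK ENVELOPE WITH DILUTE CONSTANTS** (the line's import after the cycle-1 reshape). For every `κ > 0`, once `σ`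
is small: in the crux's pre-shock frame, for every `t < T`, an envelope on `[0, t]` with constants satisfying `C (2π/β)^{3/2} σ³ max(1, β⁻¹) ≤ κ`
(`0 ≤ C`; the `β⁻¹` serves the kinetic tag). Item 13677 (`LanfordEnvelopeR`) gives the envelope but NOT the constants clause; the clause is what makes the envelope
exclude close-packed droplets, which the untagged branch cannot price (see the file docstring). Conjecture-grade, 13677-kind. At
equilibrium `C (2π/β)^{3/2} = 2`, `β = 1/θ₀` (p129630): the clause reads `2σ³ max(1,θ₀) ≤ κ`. -/
def PreShockEnvelopeDilute : Prop :=
  ∀ (a₀ θ₀ : T3 → ℝ) (u₀ : T3 → V3), Continuous a₀ → Continuous θ₀ → Continuous u₀ →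
    (∀ x, 0 < a₀ x) → (∀ x, 0 < θ₀ x) → ∀ κ : ℝ, 0 < κ → ∃ σ₀ : ℝ, 0 < σ₀ ∧ ∀ σ : ℝ, 0 < σ → σ < σ₀ →
    ∀ (T : ℝ) (ρ θ : ℝ → T3 → ℝ) (u : ℝ → T3 → V3), IsHardSphereEulerSolution σ T ρ u θ →
    ∀ Φ : (N : ℕ) → Flow σ N,
    TendstoHydroFieldsAt (fun N => localGibbsLaw σ a₀ u₀ θ₀ N (Φ N)) Φ ρ u θ 0 →
    ∀ t ∈ Set.Ico 0 T, ∃ β C : ℝ, 0 < β ∧ 0 ≤ C ∧ C * (2 * Real.pi / β) ^ (3 / 2 : ℝ) * σ ^ 3 * max 1 β⁻¹ ≤ κ ∧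
      EnvelopeOn σ a₀ θ₀ u₀ Φ t β C

/-- The dilute envelope implies the plain one (take `κ := 1` and forget the constants clause). -/
theorem preShockEnvelope_of_dilute (h : PreShockEnvelopeDilute) : PreShockEnvelope := by
  intro a₀ θ₀ u₀ ha hθ hu ha0 hθ0
  obtain ⟨σ₀, hσ₀, h⟩ := h a₀ θ₀ u₀ ha hθ hu ha0 hθ0 1 one_pos
  refine ⟨σ₀, hσ₀, fun σ hσ hσlt T ρ θ u hsol Φ hLLN t ht => ?_⟩
  obtain ⟨β, C, hβ, -, -, hE⟩ := h σ hσ hσlt T ρ θ u hsol Φ hLLN t ht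
  exact ⟨β, C, hβ, fun N k r hr => hE N k r hr⟩

/-- **The abnormal-mean bound for ONE profile triple / diameter / flow family on the horizon `t`**, with the dense-phase range
`y₀ · σ³ ≤ 1` of the tagging threshold (the body of `AbnormalActivityVanishes'` behind its prefix). -/
def AbnormalSmallOn (σ : ℝ) (a₀ θ₀ : T3 → ℝ) (u₀ : T3 → V3) (Φ : (N : ℕ) → Flow σ N) (t : ℝ) : Prop :=
  ∃ y₀ : ℝ, 0 < y₀ ∧ y₀ * σ ^ 3 ≤ 1 ∧ ∀ y : ℝ, y₀ ≤ y → ∀ η : ℝ, 0 < η →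
    ∃ Θ : ℝ, 0 < Θ ∧ ∃ K : ℕ, ∀ τ : ℝ, 0 < τ → ∃ N₀ : ℕ, ∀ N : ℕ, N₀ ≤ N → ∀ s ∈ Set.Icc 0 t,
      ∫⁻ z, ENNReal.ofReal (((N : ℝ) + 1)⁻¹ *
          ∑ i : Fin (N + 1), (tagAct Θ y K (Φ N) τ s i z + hotAct Θ (Φ N) τ s i z))
        ∂(localGibbsLaw σ a₀ u₀ θ₀ N (Φ N)) ≤ ENNReal.ofReal η

/-- `AbnormalActivityVanishes` with the dense-phase range `y₀ · σ³ ≤ 1` of the delivered threshold (otherwise verbatim). -/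
def AbnormalActivityVanishes' : Prop :=
  ∀ (a₀ θ₀ : T3 → ℝ) (u₀ : T3 → V3), Continuous a₀ → Continuous θ₀ → Continuous u₀ →
    (∀ x, 0 < a₀ x) → (∀ x, 0 < θ₀ x) → ∃ σ₀ : ℝ, 0 < σ₀ ∧ ∀ σ : ℝ, 0 < σ → σ < σ₀ →
    ∀ (T : ℝ) (ρ θ : ℝ → T3 → ℝ) (u : ℝ → T3 → V3), IsHardSphereEulerSolution σ T ρ u θ →
    ∀ Φ : (N : ℕ) → Flow σ N,
    TendstoHydroFieldsAt (fun N => localGibbsLaw σ a₀ u₀ θ₀ N (Φ N)) Φ ρ u θ 0 →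
    ∀ t ∈ Set.Ico 0 T, AbnormalSmallOn σ a₀ θ₀ u₀ Φ t

/-- **STUB 5' — ABNORMAL ACTIVITY FROM A DILUTE ENVELOPE, LOCALLY** (profiles, diameter, flow family and horizon fixed; no Euler
data): for continuous positive profiles there are an absolute diluteness demand `κ₅` and a threshold `σ₅` such that for `0 < σ < σ₅`,
every flow family and every `0 ≤ t < t₁`, an envelope on `[0, t₁]` with constants `C (2π/β)^{3/2} σ³ max(1,β⁻¹) ≤ κ₅` gives the abnormal-mean bound
for all starts `≤ t` (windows `τℓ → 0` fit below `t₁` for `N ≥ N₀(τ)`). Mechanism as in `AbnormalActivityVanishes` (marked collision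
fluxes: hot two-point flux Gaussian-small in `Θ`; tagged `(⌈yK'⌉+1)`-point fluxes `≤ (CK')^{yK'}/(yK')!`, geometric in `K'` once
`y ≥ y₀ := C(2π/β)^{3/2} max(2e, 12/β)` — count tag resp. kinetic tag —, and `y₀ σ³ ≤ 1` by diluteness with `κ₅ = 1/12`). -/
def AbnormalFromEnvelope : Prop :=
  ∀ (a₀ θ₀ : T3 → ℝ) (u₀ : T3 → V3), Continuous a₀ → Continuous θ₀ → Continuous u₀ →
    (∀ x, 0 < a₀ x) → (∀ x, 0 < θ₀ x) → ∃ κ₅ : ℝ, 0 < κ₅ ∧ ∃ σ₅ : ℝ, 0 < σ₅ ∧ ∀ σ : ℝ, 0 < σ → σ < σ₅ →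
    ∀ (Φ : (N : ℕ) → Flow σ N) (t t₁ β C : ℝ), 0 ≤ t → t < t₁ → 0 < β → 0 ≤ C →
      C * (2 * Real.pi / β) ^ (3 / 2 : ℝ) * σ ^ 3 * max 1 β⁻¹ ≤ κ₅ →
      EnvelopeOn σ a₀ θ₀ u₀ Φ t₁ β C → AbnormalSmallOn σ a₀ θ₀ u₀ Φ t

/-- The local stub 5' and the dilute import give the global abnormal statement (`t₁ := (t + T)/2`). -/
theorem abnormalActivityVanishes'_of_local (h5 : AbnormalFromEnvelope) (h4 : PreShockEnvelopeDilute) :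
    AbnormalActivityVanishes' := by
  intro a₀ θ₀ u₀ ha hθ hu ha0 hθ0
  obtain ⟨κ₅, hκ₅, σ₅, hσ₅, h5⟩ := h5 a₀ θ₀ u₀ ha hθ hu ha0 hθ0
  obtain ⟨σ₄, hσ₄, h4⟩ := h4 a₀ θ₀ u₀ ha hθ hu ha0 hθ0 κ₅ hκ₅
  refine ⟨min σ₄ σ₅, lt_min hσ₄ hσ₅, fun σ hσ hσlt T ρ θ u hsol Φ hLLN t ht => ?_⟩
  have hσ₄' : σ < σ₄ := hσlt.trans_le (min_le_left _ _)
  have hσ₅' : σ < σ₅ := hσlt.trans_le (min_le_right _ _)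
  have ht₁ : (t + T) / 2 ∈ Set.Ico 0 T := ⟨by linarith [ht.1, ht.2], by linarith [ht.2]⟩
  obtain ⟨β, C, hβ, hC, hdil, hE⟩ := h4 σ hσ hσ₄' T ρ θ u hsol Φ hLLN _ ht₁
  exact h5 σ hσ hσ₅' Φ t ((t + T) / 2) β C ht.1 (by linarith [ht.2]) hβ hC hdil hE

/-! ## §2' The composition with guards -/

section Composition

variable {σ : ℝ} {N : ℕ}

/-- **COMPOSITION (guarded)** — `UntaggedActivityTails'` and `AbnormalActivityVanishes'` imply the crux, by name; the abnormal branch's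
threshold `y₀` satisfies the dense-phase guard, which the untagged branch consumes. Proof verbatim `stub_plaqueComposition` otherwise. -/
theorem stub_plaqueCompositionDilute : UntaggedActivityTails' → AbnormalActivityVanishes' →
    Summit.AtomisticToContinuum.HydrodynamicLimit.Theses.OneFlightGossipEngine.CollisionActivityTails := by
  intro hU hR a₀ θ₀ u₀ ha hθ hu ha0 hθ0
  obtain ⟨σ₁, hσ₁, hU⟩ := hU a₀ θ₀ u₀ ha hθ hu ha0 hθ0
  obtain ⟨σ₂, hσ₂, hR⟩ := hR a₀ θ₀ u₀ ha hθ hu ha0 hθ0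
  refine ⟨min σ₁ σ₂, lt_min hσ₁ hσ₂, ?_⟩
  intro σ hσ hσlt T ρ θ u hsol Φ hLLN t ht
  have hσ₁' : σ < σ₁ := hσlt.trans_le (min_le_left _ _)
  have hσ₂' : σ < σ₂ := hσlt.trans_le (min_le_right _ _)
  obtain ⟨y₀, hy₀, hyσ, hR⟩ := hR σ hσ hσ₂' T ρ θ u hsol Φ hLLN t ht
  obtain ⟨V₀, hV₀, hU⟩ := hU σ hσ hσ₁' T ρ θ u hsol Φ hLLN t ht y₀ hy₀ hyσ
  refine ⟨3 * V₀, by positivity, ?_⟩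
  intro V hV ε hε
  have hε9 : 0 < ε / 9 := by positivity
  obtain ⟨Θ, hΘ, K, hR⟩ := hR y₀ le_rfl (ε / 9) hε9
  obtain ⟨τ₀, hτ₀, hU⟩ := hU (V / 3) (by linarith) Θ hΘ K (ε / 9) hε9
  refine ⟨τ₀, hτ₀, fun τ hτ => ?_⟩
  have hτpos : 0 < τ := hτ₀.trans_le hτ
  obtain ⟨N₁, hU⟩ := hU τ hτ
  obtain ⟨N₂, hR⟩ := hR τ hτpos
  refine ⟨max N₁ N₂, fun N hN s hs => ?_⟩
  -- the crux body: `let w; let P; let act; ∫⁻ … ≤ …` — zeta-reduce and fold the landed `act` / `window`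
  show ∫⁻ z, ENNReal.ofReal (((N : ℝ) + 1)⁻¹ * ∑ i : Fin (N + 1), tailFn V (act (Φ N) τ s i z))
      ∂(localGibbsLaw σ a₀ u₀ θ₀ N (Φ N)) ≤ ENNReal.ofReal ε
  obtain ⟨hmeas, hUb⟩ := hU N (le_of_max_le_left hN) s hs
  have hRb := hR N (le_of_max_le_right hN) s hs
  set P := localGibbsLaw σ a₀ u₀ θ₀ N (Φ N) with hP
  -- pathwise bound, a.e. (the local Gibbs law is carried by the good set)
  have hN1 : (0 : ℝ) < (N : ℝ) + 1 := by positivity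
  have hae : ∀ᵐ z ∂P,
      ((N : ℝ) + 1)⁻¹ * ∑ i : Fin (N + 1), tailFn V (act (Φ N) τ s i z) ≤
        3 * ((((N : ℝ) + 1)⁻¹ * ∑ i : Fin (N + 1), tailFn (V / 3) (uncAct Θ y₀ K (Φ N) τ s i z)) +
          (((N : ℝ) + 1)⁻¹ * ∑ i : Fin (N + 1),
            (tagAct Θ y₀ K (Φ N) τ s i z + hotAct Θ (Φ N) τ s i z))) := by
    filter_upwards [ae_mem_good_localGibbsLaw σ a₀ θ₀ u₀ N (Φ N)] with z hz
    have hpt : ∀ i : Fin (N + 1), tailFn V (act (Φ N) τ s i z) ≤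
        3 * (tailFn (V / 3) (uncAct Θ y₀ K (Φ N) τ s i z) +
          (tagAct Θ y₀ K (Φ N) τ s i z + hotAct Θ (Φ N) τ s i z)) := fun i => by
      have := tailFn_act_le_three hσ.le (Θ := Θ) (y := y₀) (K := K) (Φ N) hτpos.le s i hz V
      linarith
    have hsum := Finset.sum_le_sum fun i (_ : i ∈ Finset.univ) => hpt i
    rw [← Finset.mul_sum, Finset.sum_add_distrib] at hsum
    have hinv : 0 ≤ ((N : ℝ) + 1)⁻¹ := inv_nonneg.2 hN1.le
    have := mul_le_mul_of_nonneg_left hsum hinv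
    nlinarith [this]
  -- integrate
  have hmeas' : AEMeasurable
      (fun z => ((N : ℝ) + 1)⁻¹ * ∑ i : Fin (N + 1), tailFn (V / 3) (uncAct Θ y₀ K (Φ N) τ s i z)) P :=
    hmeas.const_mul _
  calc ∫⁻ z, ENNReal.ofReal (((N : ℝ) + 1)⁻¹ * ∑ i : Fin (N + 1), tailFn V (act (Φ N) τ s i z)) ∂P
      ≤ ∫⁻ z, ENNReal.ofReal (3 * ((((N : ℝ) + 1)⁻¹ *
            ∑ i : Fin (N + 1), tailFn (V / 3) (uncAct Θ y₀ K (Φ N) τ s i z)) +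
          (((N : ℝ) + 1)⁻¹ * ∑ i : Fin (N + 1),
            (tagAct Θ y₀ K (Φ N) τ s i z + hotAct Θ (Φ N) τ s i z)))) ∂P :=
        lintegral_mono_ae (hae.mono fun z hz => ENNReal.ofReal_le_ofReal hz)
    _ ≤ ENNReal.ofReal 3 * (∫⁻ z, ENNReal.ofReal (((N : ℝ) + 1)⁻¹ *
            ∑ i : Fin (N + 1), tailFn (V / 3) (uncAct Θ y₀ K (Φ N) τ s i z)) ∂P +
          ∫⁻ z, ENNReal.ofReal (((N : ℝ) + 1)⁻¹ * ∑ i : Fin (N + 1),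
            (tagAct Θ y₀ K (Φ N) τ s i z + hotAct Θ (Φ N) τ s i z)) ∂P) :=
        lintegral_ofReal_mul_add_le (by norm_num) hmeas'
    _ ≤ ENNReal.ofReal 3 * (ENNReal.ofReal (ε / 9) + ENNReal.ofReal (ε / 9)) := by
        gcongr
    _ = ENNReal.ofReal (3 * (ε / 9 + ε / 9)) := by
        rw [← ENNReal.ofReal_add hε9.le hε9.le, ← ENNReal.ofReal_mul (by norm_num)]
    _ ≤ ENNReal.ofReal ε := ENNReal.ofReal_le_ofReal (by linarith)


end Composition

end Summit.AtomisticToContinuum.HydrodynamicLimit.Theorems.CollisionActivityTailsPlaqueSplit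

end
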